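import Mathlib.LinearAlgebra.Isomorphisms
import Literature.AnabelianGeometry.AbsoluteAnabelian.AbsTopI.Lem27Module
import HarnessLib

/-!
# [AbsTopI] Lemma 2.7 (iii) PROVED from (ii)(c) — proof-only companion of `AbsTopI/Lem27Module.lean`

S. Mochizuki, *Topics in Absolute Anabelian Geometry I: Generalities* (2012) [AbsTopI], Lemma 2.7 (iii)
p. 24–25 and its printed proof (p. 25 l. 3–6): "Assertion (iii) follows by considering the long exact
cohomology sequence associated to the short exact sequence `0 → Hom(R, Ẑ) → Hom(T(B), Ẑ) → Hom(N, Ẑ) → 0`,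
since the fact that `N` has no nonzero torsion-free subquotients on which `G_k` acts through a finite
quotient implies that `H⁰(G_k, Hom(N, Ẑ)) = 0`."

abc-iut cell, row «LEM27iii-MODULE» (abc-iut-L4-lead 12:02:17Z GO (a)), seat abc-iut-w5-d058 (gen 8).
PROOF-ONLY (no def / instance / structure / Prop fact), over Mathlib's continuous representations: for a
surjective continuous intertwining map `p : π →ⁱL τ` (`ContIntertwiningMap`) and any `ℤ`-torsion-free
coefficient ring `Λ` (print: `Λ = Ẑ`): `Lem27.ker_mem_invtSubmodule`, `Lem27.homG_ker_eq_zero`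
("`H⁰(G_k, Hom(N, Ẑ)) = 0`" from (ii)(c)) and `Lem27.lem27iii` — a cochain `c : G → Hom(R, Λ)` whose
pull-back along `T ↠ R` is the coboundary of some `t ∈ Hom(T, Λ)` for the contragredient actions
(`Representation.dual`) is the coboundary of some `r ∈ Hom(R, Λ)`, i.e. `H¹(G, Hom(R, Λ)) → H¹(G, Hom(T, Λ))`
is injective (continuous or abstract cochains).  Nothing here bears on [IUTchIII] Cor. 3.12.
-/

namespace Literature.AnabelianGeometry.AbsoluteAnabelian.AbsTopI

namespace Lem27

variable {Λ : Type*} [CommRing Λ] {G : Type*} [Group G] [TopologicalSpace G]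
  {V : Type*} [AddCommGroup V] [Module Λ V] [TopologicalSpace V] [IsTopologicalAddGroup V]
  {W : Type*} [AddCommGroup W] [Module Λ W] [TopologicalSpace W] [IsTopologicalAddGroup W]
  {π : ContRepresentation Λ G V} {τ : ContRepresentation Λ G W} (p : ContIntertwiningMap π τ)

omit [TopologicalSpace G] in
/-- A continuous intertwining map intertwines, pointwise. [cite: MochizukiAbsTopI2012, Lemma 2.7 (ii) p.24] -/
theorem map_apply_eq (g : G) (v : V) :
    p.toContinuousLinearMap (π g v) = τ g (p.toContinuousLinearMap v) := by
  have h := p.isIntertwining' g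
  exact congr($h v)

omit [TopologicalSpace G] in
/-- The same with the actions written through `ContRepresentation.toRepresentation`.
[cite: MochizukiAbsTopI2012, Lemma 2.7 (ii) p.24] -/
theorem map_toRepresentation_apply (g : G) (v : V) :
    p.toContinuousLinearMap ((π.toRepresentation) g v) =
      (τ.toRepresentation) g (p.toContinuousLinearMap v) :=
  map_apply_eq p g v

omit [TopologicalSpace G] in
/-- The kernel `N := Ker(T ↠ R)` of an intertwining map is `G`-invariant.
[cite: MochizukiAbsTopI2012, Lemma 2.7 (ii) p.24] -/
theorem ker_mem_invtSubmodule :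
    LinearMap.ker (p.toContinuousLinearMap : V →ₗ[Λ] W) ∈ (π.toRepresentation).invtSubmodule := by
  rw [Representation.mem_invtSubmodule]
  intro g x hx
  rw [Submodule.mem_comap, LinearMap.mem_ker]
  have hx' : p.toContinuousLinearMap x = 0 := hx
  change p.toContinuousLinearMap ((π.toRepresentation) g x) = 0
  rw [map_toRepresentation_apply, hx', map_zero]

omit [TopologicalSpace G] in
/-- Pointwise form of the invariance of the kernel. [cite: MochizukiAbsTopI2012, Lemma 2.7 (ii) p.24] -/
theorem apply_mem_ker (g : G) {x : V} (hx : x ∈ LinearMap.ker (p.toContinuousLinearMap : V →ₗ[Λ] W)) :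
    (π.toRepresentation) g x ∈ LinearMap.ker (p.toContinuousLinearMap : V →ₗ[Λ] W) :=
  (Representation.mem_invtSubmodule _).1 (ker_mem_invtSubmodule p) g hx

/-- **"`H⁰(G_k, Hom(N, Ẑ)) = 0`"** (print, proof of (iii), p. 25): under (ii)(c) for `N = Ker(T ↠ R)` and
for a `ℤ`-torsion-free coefficient ring `Λ`, every `G`-invariant `Λ`-linear form on `N` vanishes — its
kernel would cut out a nonzero torsion-free subquotient `N/Ker` with TRIVIAL `G`-action.
[cite: MochizukiAbsTopI2012, Lemma 2.7 (iii) p.25] -/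
theorem homG_ker_eq_zero (hΛ : ∀ (k : ℕ) (a : Λ), k ≠ 0 → k • a = 0 → a = 0)
    (hc : NoFiniteActionSubquotient π (LinearMap.ker (p.toContinuousLinearMap : V →ₗ[Λ] W)))
    (f : LinearMap.ker (p.toContinuousLinearMap : V →ₗ[Λ] W) →ₗ[Λ] Λ)
    (hf : ∀ (g : G) (x : V) (hx : x ∈ LinearMap.ker (p.toContinuousLinearMap : V →ₗ[Λ] W)),
      f ⟨(π.toRepresentation) g x, apply_mem_ker p g hx⟩ = f ⟨x, hx⟩) :
    f = 0 := by
  classical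
  by_contra hne
  -- `N₁ := Ker f ⊆ N := Ker p`, as a submodule of `V`
  let N : Submodule Λ V := LinearMap.ker (p.toContinuousLinearMap : V →ₗ[Λ] W)
  let N₁ : Submodule Λ V := (LinearMap.ker f).map N.subtype
  have mem_N₁ : ∀ x : V, x ∈ N₁ ↔ ∃ hx : x ∈ N, f ⟨x, hx⟩ = 0 := by
    intro x
    constructor
    · rintro ⟨y, hy, rfl⟩
      exact ⟨y.2, by simpa using hy⟩
    · rintro ⟨hx, h0⟩
      exact ⟨⟨x, hx⟩, by simpa using h0, rfl⟩
  have hN₁N : N₁ ≤ N := fun x hx => ((mem_N₁ x).1 hx).1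
  have hst₁ : N₁ ∈ (π.toRepresentation).invtSubmodule := by
    rw [Representation.mem_invtSubmodule]
    intro g x hx
    obtain ⟨hxN, h0⟩ := (mem_N₁ x).1 hx
    exact (mem_N₁ _).2 ⟨apply_mem_ker p g hxN, by rw [hf g x hxN, h0]⟩
  have hne' : N₁ ≠ N := by
    intro h
    apply hne
    ext ⟨x, hx⟩
    have hx₁ : x ∈ N₁ := h ▸ hx
    obtain ⟨hx', h0⟩ := (mem_N₁ x).1 hx₁
    simpa using h0
  have hsat : ∀ (k : ℕ) (x : V), x ∈ N → k ≠ 0 → k • x ∈ N₁ → x ∈ N₁ := by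
    intro k x hxN hk hkx
    obtain ⟨hkN, h0⟩ := (mem_N₁ _).1 hkx
    refine (mem_N₁ x).2 ⟨hxN, hΛ k _ hk ?_⟩
    have : (⟨k • x, hkN⟩ : N) = k • ⟨x, hxN⟩ := rfl
    rw [this, map_nsmul] at h0
    exact h0
  refine hc N₁ N hN₁N le_rfl hst₁ (ker_mem_invtSubmodule p) hne' hsat ⟨⊤, ?_, ?_⟩
  · rw [Subgroup.coe_top]; exact isOpen_univ
  · intro g _ x hxN
    have hgx : (π.toRepresentation) g x ∈ N := apply_mem_ker p g hxN
    refine (mem_N₁ _).2 ⟨N.sub_mem hgx hxN, ?_⟩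
    have : (⟨π g x - x, N.sub_mem hgx hxN⟩ : N) = ⟨(π.toRepresentation) g x, hgx⟩ - ⟨x, hxN⟩ := rfl
    rw [this, map_sub, hf g x hxN, sub_self]

/-- **[AbsTopI] Lemma 2.7 (iii), PROVED from (ii)(c)** ("If `R` is as in (ii), then the natural map
`H¹(G_k, Hom(R, Ẑ)) → H¹(G_k, Hom(T(B), Ẑ))` is injective", p. 24–25), in explicit cochain form over any
`ℤ`-torsion-free coefficient ring `Λ`, for a surjective continuous intertwining map `p : T ↠ R`: if a cochain
`c : G → Hom(R, Λ)` pulled back along `p` is the coboundary `g ↦ g·t − t` of some `t ∈ Hom(T, Λ)` for the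
contragredient action (`Representation.dual`), then `c` itself is the coboundary of some `r ∈ Hom(R, Λ)` —
so a class of `H¹(G, Hom(R, Λ))` dying in `H¹(G, Hom(T, Λ))` is zero, for continuous and for abstract
cochains alike.  Print's proof: `t` is `G`-invariant on `N = Ker p`, hence zero there (`homG_ker_eq_zero`),
hence `t = r ∘ p`, and `p` is an epimorphism. [cite: MochizukiAbsTopI2012, Lemma 2.7 (iii) p.24] -/
theorem lem27iii (hΛ : ∀ (k : ℕ) (a : Λ), k ≠ 0 → k • a = 0 → a = 0)
    (hsurj : Function.Surjective p.toContinuousLinearMap)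
    (hc : NoFiniteActionSubquotient π (LinearMap.ker (p.toContinuousLinearMap : V →ₗ[Λ] W)))
    (c : G → Module.Dual Λ W) (t : Module.Dual Λ V)
    (ht : ∀ g : G, c g ∘ₗ (p.toContinuousLinearMap : V →ₗ[Λ] W) =
      (π.toRepresentation).dual g t - t) :
    ∃ r : Module.Dual Λ W, ∀ g : G, c g = (τ.toRepresentation).dual g r - r := by
  -- `t` is `G`-invariant on `N = Ker p`
  have hinv : ∀ (g : G) (x : V), x ∈ LinearMap.ker (p.toContinuousLinearMap : V →ₗ[Λ] W) →
      t ((π.toRepresentation) g x) = t x := by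
    intro g x hx
    have h := LinearMap.congr_fun (ht g⁻¹) x
    rw [LinearMap.mem_ker] at hx
    simp only [LinearMap.coe_comp, Function.comp_apply, hx, map_zero, LinearMap.sub_apply,
      Representation.dual_apply, Module.Dual.transpose_apply, inv_inv] at h
    exact sub_eq_zero.mp h.symm
  -- hence `t` vanishes on `N` ("`H⁰(G_k, Hom(N, Ẑ)) = 0`")
  have hzero : ∀ x : V, x ∈ LinearMap.ker (p.toContinuousLinearMap : V →ₗ[Λ] W) → t x = 0 := by
    have h0 := homG_ker_eq_zero p hΛ hc
      (t ∘ₗ (LinearMap.ker (p.toContinuousLinearMap : V →ₗ[Λ] W)).subtype)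
      (fun g x hx => by simpa using hinv g x hx)
    intro x hx
    simpa using LinearMap.congr_fun h0 ⟨x, hx⟩
  -- so `t` factors through `p`: `t = r ∘ p`
  have hle : LinearMap.ker (p.toContinuousLinearMap : V →ₗ[Λ] W) ≤ LinearMap.ker t :=
    fun x hx => hzero x hx
  let r : Module.Dual Λ W :=
    ((LinearMap.ker (p.toContinuousLinearMap : V →ₗ[Λ] W)).liftQ t hle) ∘ₗ
      ((p.toContinuousLinearMap : V →ₗ[Λ] W).quotKerEquivOfSurjective hsurj).symm.toLinearMap
  have hr : r ∘ₗ (p.toContinuousLinearMap : V →ₗ[Λ] W) = t := by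
    ext v
    have hv : ((p.toContinuousLinearMap : V →ₗ[Λ] W).quotKerEquivOfSurjective hsurj).symm
        (p.toContinuousLinearMap v) = Submodule.Quotient.mk v := by
      rw [LinearEquiv.symm_apply_eq, LinearMap.quotKerEquivOfSurjective_apply_mk]
      rfl
    simp only [r, LinearMap.coe_comp, Function.comp_apply, LinearEquiv.coe_toLinearMap,
      ContinuousLinearMap.coe_coe, hv, Submodule.liftQ_apply]
  refine ⟨r, fun g => ?_⟩
  -- compare after composing with the epimorphism `p`
  have hsurj' : Function.Surjective (p.toContinuousLinearMap : V →ₗ[Λ] W) := hsurj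
  rw [← LinearMap.cancel_right hsurj', ht g, LinearMap.sub_comp, hr]
  congr 1
  ext v
  simp only [LinearMap.coe_comp, Function.comp_apply, Representation.dual_apply,
    Module.Dual.transpose_apply, ContinuousLinearMap.coe_coe]
  rw [← hr, LinearMap.coe_comp, Function.comp_apply, ContinuousLinearMap.coe_coe,
    map_toRepresentation_apply]

end Lem27

end Literature.AnabelianGeometry.AbsoluteAnabelian.AbsTopI
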